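import Mathlib
import Literature.NumberTheory.Irrationality.Brown2016.DinnerParties
import Summits.KontsevichZagierPeriods.Zeta5Search.Families.CellularIntegral
import HarnessLib

/-!
# ζ(5) search — Families: Brown's worked examples (`N = 5, 6` Rhin–Viola families; the generalised `₈π₈` family)

HONEST FRAMING: systematic search; no irrationality claim unless certified.

Cell `pub-zeta5`, seat P2 (entry points for `fam-rv` and `fam-brown8`).  The three worked examples of F. Brown,
arXiv:1412.6508 [Brown2016], §5.3, as instances of `Families/CellularIntegral.lean`, each with TWO ANCHORS proved against
the printed text for all integer parameters: the displayed integrand in simplicial coordinates (on the nose) and the printed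
region of convergence (as an `iff` for `BrownConvergent`, on Brown's lattice `H_σ` when `n` is even):

* §5.3.1, `N = 5`, `σ = (5,2,4,1,3)`: Dixon's / Rhin–Viola's `ζ(2)` integrals; `den5`, `homogeneous_five`,
  `integrand_five`, `brownConvergent_five_iff` ("exactly `a_i ≥ 0`").
* §5.3.2, `N = 6`, `σ = (1,4,2,6,3,5)` (`~ ₆π`): Rhin–Viola's `ζ(3)` integrals (Lemma 5.5); `den6`,
  `homogeneous_six_iff` (`↔ a₄+a₅ = a₁+a₂`), `integrand_six` (eq. (5.8)), `brownConvergent_six_iff`.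
* §5.3.3, `N = 8`, `σ = (8,2,7,3,6,4,1,5)` (`~ ₈π₈ = ⁸π_odd = Brown2016.reps8[8]`, kernel-decided): the generalised `₈π₈`
  family ("linear combinations of `1, ζ(3), ζ(5)` only", experimentally); `den8`, `homogeneous_eight_iff`
  (`↔ a₆+a₇+a₈ = a₂+a₃+a₄`), `integrand_eight`, `brownConvergent_eight_iff` (Brown's reduced set of four hyperplanes plus
  `a_i ≥ 0`; "All other convergence conditions are a consequence of these ones" — PROVED).
Parameters are 0-based: `a : Fin n → ℤ` with `a i = a_{i+1,i+2}`.
-/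

noncomputable section

open MeasureTheory Finset Set

namespace Summit.KontsevichZagierPeriods.Zeta5Search.Families.Cellular

open Literature.NumberTheory.Irrationality

/-! ### `N = 5`: Dixon's / Rhin–Viola's integrals for `ζ(2)` [Brown2016, §5.3.1] -/

/-- `₅π = (5,2,4,1,3)` [Brown2016, App. 2 §10.1.1, §5.3.1] as a map `Fin 5 → Fin 5` (0-based `(4,1,3,0,2)`). -/
def sigma5 : Fin 5 → Fin 5 := ![4, 1, 3, 0, 2]

/-- `sigma5` is the printed plan `[5,2,4,1,3] = Brown2016.reps5[0]`, read 0-based; it is injective. -/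
theorem sigma5_eq_ofSeating : sigma5 = ofSeating (ℓ := 2) [5, 2, 4, 1, 3] ∧ Brown2016.reps5 = [[5, 2, 4, 1, 3]] ∧
    Function.Injective sigma5 := by
  refine ⟨by decide, rfl, by decide⟩

/-- Denominator exponents of the `N = 5` family in Brown's parameters `a_i = a_{i,i+1}` (`n` odd: the `b`'s are determined
by homogeneity): by position on `σδ⁰ = (5,2,4,1,3)`: `b₅₂ = a₁−a₃+a₅`, `b₂₄ = a₂+a₃−a₅`, `b₄₁ = a₄+a₅−a₂`,
`b₁₃ = a₁+a₂−a₄`, `b₃₅ = a₃+a₄−a₁` (`b₁₃, b₂₄` printed in [Brown2016, §5.3.1]). -/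
def den5 (a : Fin 5 → ℤ) : Fin 5 → ℤ :=
  ![a 0 - a 2 + a 4, a 1 + a 2 - a 4, a 3 + a 4 - a 1, a 0 + a 1 - a 3, a 2 + a 3 - a 0]

/-- Homogeneity of the `N = 5` family for every `a ∈ ℤ⁵`. [Brown2016, (5.2), §5.3.1] -/
theorem homogeneous_five (a : Fin 5 → ℤ) : Homogeneous sigma5 a (den5 a) := by
  have e : (-1 : Fin 5) = 4 := by decide
  intro i
  fin_cases i <;> simp [sigma5, den5, e] <;> ring

/-- ANCHOR [Brown2016, §5.3.1, display]: "The generalised cellular integral in simplicial coordinates is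
`∫ t₁^{a₁}(t₂−t₁)^{a₂}(1−t₂)^{a₃} / (t₂^{b₁₃}(1−t₁)^{b₂₄}) · dt₁dt₂/((1−t₁)t₂)` where `b₁₃ = a₁+a₂−a₄` and
`b₂₄ = a₂+a₃−a₅`". -/
theorem integrand_five (a : Fin 5 → ℤ) (t : Fin 2 → ℝ) :
    integrand sigma5 a (den5 a) t =
      t 0 ^ (a 0) * (t 1 - t 0) ^ (a 1) * (1 - t 1) ^ (a 2) /
        ((t 1) ^ (a 0 + a 1 - a 3) * (1 - t 0) ^ (a 1 + a 2 - a 4)) / ((1 - t 0) * t 1) := by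
  simp [integrand, num, den, formDen, Fin.prod_univ_five, sigma5, den5, ef, pt, max_def, min_def]
  ring

/-- ANCHOR [Brown2016, §5.3.1]: "There are exactly five divisors at finite distance … and therefore the convergence
conditions are exactly `a_i ≥ 0` for `i ∈ ℤ/5ℤ`." -/
theorem brownConvergent_five_iff (a : Fin 5 → ℤ) : BrownConvergent sigma5 a (den5 a) ↔ ∀ i, 0 ≤ a i := by
  rw [forall_fin5]
  unfold BrownConvergent twoOrd
  dsimp only [Nat.reduceAdd]
  simp only [forall_fin5, forall_fin2, Fin.sum_univ_five]
  simp [sameSide, sigma5, den5]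
  constructor <;> intro h <;> and_intros <;> omega

/-! ### `N = 6`: Rhin–Viola's integrals for `ζ(3)` [Brown2016, §5.3.2, Lemma 5.5] -/

/-- `σ = (1,4,2,6,3,5)` [Brown2016, §5.3.2] as a map `Fin 6 → Fin 6` (0-based `(0,3,1,5,2,4)`); it is equivalent to
the printed representative `₆π = [6,2,4,1,5,3]` of the unique convergent configuration on six points. -/
def sigma6 : Fin 6 → Fin 6 := ![0, 3, 1, 5, 2, 4]

/-- `sigma6` is `(1,4,2,6,3,5)` read 0-based, injective, and in the configuration `₆π = Brown2016.reps6[0]`. -/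
theorem sigma6_eq_ofSeating : sigma6 = ofSeating (ℓ := 3) [1, 4, 2, 6, 3, 5] ∧ Function.Injective sigma6 ∧
    Brown2016.Equivalent 6 [1, 4, 2, 6, 3, 5] [6, 2, 4, 1, 5, 3] ∧ Brown2016.reps6 = [[6, 2, 4, 1, 5, 3]] := by
  refine ⟨by decide, by decide, by decide, rfl⟩

/-- Denominator exponents of the `N = 6` family in Brown's parameters `a_i = a_{i,i+1}` and `b = b₃₆`, by position on
`σδ⁰ = (1,4,2,6,3,5)`: `b₁₄ = a₆+a₃−b`, `b₂₄ = a₄−a₆+b` [printed], `b₂₆ = a₁+a₂−a₄+a₆−b`, `b₃₆ = b`,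
`b₃₅ = a₂+a₃−b` [printed], `b₁₅ = a₁−a₃+b`. [Brown2016, §5.3.2] -/
def den6 (a : Fin 6 → ℤ) (b : ℤ) : Fin 6 → ℤ :=
  ![a 5 + a 2 - b, a 3 - a 5 + b, a 0 + a 1 - a 3 + a 5 - b, b, a 1 + a 2 - b, a 0 - a 2 + b]

/-- Homogeneity of the `N = 6` family holds exactly on Brown's lattice `H_σ : a₄ + a₅ = a₁ + a₂` (eq. (5.5) for this `σ`).
[Brown2016, §5.2 (5.5), §5.3.2] -/
theorem homogeneous_six_iff (a : Fin 6 → ℤ) (b : ℤ) : Homogeneous sigma6 a (den6 a b) ↔ a 3 + a 4 = a 0 + a 1 := by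
  unfold Homogeneous
  dsimp only [Nat.reduceAdd]
  rw [show (∀ i : Fin 6, a (sigma6 i - 1) + a (sigma6 i) = den6 a b (i - 1) + den6 a b i) ↔
      ∀ i : Fin 6, (a (sigma6 i - 1) + a (sigma6 i) = den6 a b (i - 1) + den6 a b i) from Iff.rfl]
  have e : (-1 : Fin 6) = 5 := by decide
  constructor
  · intro h
    have h5 := h 5
    simp [sigma6, den6] at h5
    linarith
  · intro h i
    fin_cases i <;> simp [sigma6, den6, e] <;> linarith

/-- ANCHOR [Brown2016, §5.3.2, eq. (5.8)]: the generalised cellular form of `σ = (1,4,2,6,3,5)` is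
`t₁^{a₁}(t₂−t₁)^{a₂}(t₃−t₂)^{a₃}(1−t₃)^{a₄} / (t₃^{b₁₄}(t₃−t₁)^{b₂₄}(1−t₂)^{b₃₅}) · dt₁dt₂dt₃/(t₃(t₃−t₁)(1−t₂))`. -/
theorem integrand_six (a : Fin 6 → ℤ) (b : ℤ) (t : Fin 3 → ℝ) :
    integrand sigma6 a (den6 a b) t =
      t 0 ^ (a 0) * (t 1 - t 0) ^ (a 1) * (t 2 - t 1) ^ (a 2) * (1 - t 2) ^ (a 3) /
        ((t 2) ^ (a 5 + a 2 - b) * (t 2 - t 0) ^ (a 3 - a 5 + b) * (1 - t 1) ^ (a 1 + a 2 - b)) /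
        (t 2 * (t 2 - t 0) * (1 - t 1)) := by
  simp [integrand, num, den, formDen, Fin.prod_univ_six, sigma6, den6, ef, pt, max_def, min_def]

/-- ANCHOR [Brown2016, §5.3.2]: on the lattice `H_σ`, the region of convergence of the `N = 6` family is cut out by
`a_i ≥ 0` (`i ∈ ℤ/6ℤ`) and the two hyperplanes `a₄ + b − a₂ ≥ 0` (`126|345`), `a₆ + a₂ + a₃ − a₄ − b ≥ 0` (`156|234`),
the third printed form `a₁ + a₂ + 1 ≥ 0` (`123|456`) being implied. -/
theorem brownConvergent_six_iff (a : Fin 6 → ℤ) (b : ℤ) (hH : a 3 + a 4 = a 0 + a 1) :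
    BrownConvergent sigma6 a (den6 a b) ↔
      (∀ i, 0 ≤ a i) ∧ 0 ≤ a 3 + b - a 1 ∧ 0 ≤ a 5 + a 1 + a 2 - a 3 - b := by
  rw [forall_fin6]
  unfold BrownConvergent twoOrd
  dsimp only [Nat.reduceAdd]
  simp only [forall_fin6, forall_fin3, Fin.sum_univ_six]
  simp [sameSide, sigma6, den6]
  constructor <;> intro h <;> and_intros <;> omega

/-! ### `N = 8`: the generalised `₈π₈ = ⁸π_odd` family, `σ = (8,2,7,3,6,4,1,5)` [Brown2016, §5.3.3] -/

/-- `σ = (8,2,7,3,6,4,1,5)` [Brown2016, §5.3.3] as a map `Fin 8 → Fin 8` (0-based `(7,1,6,2,5,3,0,4)`). -/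
def pi8 : Fin 8 → Fin 8 := ![7, 1, 6, 2, 5, 3, 0, 4]

/-- `pi8` is `(8,2,7,3,6,4,1,5)` read 0-based, injective, and lies in the configuration `₈π₈ = [8,2,5,1,6,4,7,3]`
(`Brown2016.reps8[8]`, the Ball–Rivoal configuration `⁸π_odd`; its dual `₈π₈^∨` is the Brown–Zudilin family). -/
theorem pi8_eq_ofSeating : pi8 = ofSeating (ℓ := 5) [8, 2, 7, 3, 6, 4, 1, 5] ∧ Function.Injective pi8 ∧
    Brown2016.Equivalent 8 [8, 2, 7, 3, 6, 4, 1, 5] [8, 2, 5, 1, 6, 4, 7, 3] ∧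
    Brown2016.reps8[8]? = some [8, 2, 5, 1, 6, 4, 7, 3] := by
  refine ⟨by decide, by decide, by decide, rfl⟩

/-- Denominator exponents of the generalised `₈π₈` family in Brown's parameters `a_i = a_{i,i+1}` (`i ∈ ℤ/8`) and
`b = b₅₈`, by position on `σδ⁰ = (8,2,7,3,6,4,1,5)`: `b₈₂ = a₂+a₃+a₄−a₆−b`, then the printed
`b₂₇ = a₁+a₆−a₃−a₄+b`, `b₃₇ = a₃+a₄+a₇−a₁−b`, `b₃₆ = a₁+a₂−a₄−a₇+b`, `b₄₆ = a₄+a₅+a₆+a₇−a₁−a₂−b`,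
`b₁₄ = a₁+a₂+a₃−a₅−a₆−a₇+b`, `b₁₅ = a₄+a₅−b`, and `b₅₈ = b`. [Brown2016, §5.3.3 eq. (5.9)] -/
def den8 (a : Fin 8 → ℤ) (b : ℤ) : Fin 8 → ℤ :=
  ![a 1 + a 2 + a 3 - a 5 - b, a 0 + a 5 - a 2 - a 3 + b, a 2 + a 3 + a 6 - a 0 - b, a 0 + a 1 - a 3 - a 6 + b,
    a 3 + a 4 + a 5 + a 6 - a 0 - a 1 - b, a 0 + a 1 + a 2 - a 4 - a 5 - a 6 + b, a 3 + a 4 - b, b]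

/-- Homogeneity of the generalised `₈π₈` family holds exactly on Brown's lattice
`H_σ : a₆ + a₇ + a₈ = a₂ + a₃ + a₄`. [Brown2016, §5.3.3] -/
theorem homogeneous_eight_iff (a : Fin 8 → ℤ) (b : ℤ) :
    Homogeneous pi8 a (den8 a b) ↔ a 5 + a 6 + a 7 = a 1 + a 2 + a 3 := by
  unfold Homogeneous
  dsimp only [Nat.reduceAdd]
  have e : (-1 : Fin 8) = 7 := by decide
  constructor
  · intro h
    have h0 := h 0
    simp [pi8, den8, e] at h0
    linarith
  · intro h i
    fin_cases i <;> simp [pi8, den8, e] <;> linarith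

/-- ANCHOR [Brown2016, §5.3.3, display]: the generalised cellular form of `σ = (8,2,7,3,6,4,1,5)` is
`t₁^{a₁}(t₂−t₁)^{a₂}(t₃−t₂)^{a₃}(t₄−t₃)^{a₄}(t₅−t₄)^{a₅}(1−t₅)^{a₆} /
((1−t₁)^{b₂₇}(1−t₂)^{b₃₇} t₃^{b₁₄} t₄^{b₁₅} (t₅−t₂)^{b₃₆}(t₅−t₃)^{b₄₆}) · ω_σ`,
`ω_σ = dt₁⋯dt₅/((1−t₁)(1−t₂)(t₅−t₂)(t₅−t₃)t₃t₄)`. -/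
theorem integrand_eight (a : Fin 8 → ℤ) (b : ℤ) (t : Fin 5 → ℝ) :
    integrand pi8 a (den8 a b) t =
      t 0 ^ (a 0) * (t 1 - t 0) ^ (a 1) * (t 2 - t 1) ^ (a 2) * (t 3 - t 2) ^ (a 3) * (t 4 - t 3) ^ (a 4) *
          (1 - t 4) ^ (a 5) /
        ((1 - t 0) ^ (a 0 + a 5 - a 2 - a 3 + b) * (1 - t 1) ^ (a 2 + a 3 + a 6 - a 0 - b) *
          (t 2) ^ (a 0 + a 1 + a 2 - a 4 - a 5 - a 6 + b) * (t 3) ^ (a 3 + a 4 - b) *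
          (t 4 - t 1) ^ (a 0 + a 1 - a 3 - a 6 + b) * (t 4 - t 2) ^ (a 3 + a 4 + a 5 + a 6 - a 0 - a 1 - b)) /
        ((1 - t 0) * (1 - t 1) * (t 4 - t 1) * (t 4 - t 2) * t 2 * t 3) := by
  simp [integrand, num, den, formDen, Fin.prod_univ_eight, pi8, den8, ef, pt, max_def, min_def]
  ring

/-- ANCHOR [Brown2016, §5.3.3]: on `H_σ`, "A reduced set of convergence conditions are given by `a_i ≥ 0` for all
`i ∈ ℤ/8ℤ`, and `a₁ + b − a₇ ≥ 0` (`128|34567`), `a₃ + a₄ − a₆ ≥ 0` (`1278|3456`), `a₅ + a₆ + a₇ − b + 1 ≥ 0`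
(`1234|5678`), `a₁ + a₂ + b − a₆ − a₇ ≥ 0` (`456|12378`) … All other convergence conditions are a consequence of these
ones." -/
theorem brownConvergent_eight_iff (a : Fin 8 → ℤ) (b : ℤ) (hH : a 5 + a 6 + a 7 = a 1 + a 2 + a 3) :
    BrownConvergent pi8 a (den8 a b) ↔
      (∀ i, 0 ≤ a i) ∧ 0 ≤ a 0 + b - a 6 ∧ 0 ≤ a 2 + a 3 - a 5 ∧ 0 ≤ a 4 + a 5 + a 6 - b + 1 ∧
        0 ≤ a 0 + a 1 + b - a 5 - a 6 := by
  rw [forall_fin8]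
  unfold BrownConvergent twoOrd
  dsimp only [Nat.reduceAdd]
  simp only [forall_fin8, forall_fin5, Fin.sum_univ_eight]
  simp [sameSide, pi8, den8]
  constructor <;> intro h <;> and_intros <;> omega

end Summit.KontsevichZagierPeriods.Zeta5Search.Families.Cellular
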